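import Summits.ABC.IUTFork.Repair.RHLevelMover
import Summits.ABC.IUTFork.Cor312LicenceOfMultiReach
import Summits.ABC.IUTFork.Cor312LicenceRealSharpMovers
import HarnessLib

/-!
# D-0079 RESCUE sub-cell R-H — BOX-FREE MULTI-REACH AT ANY PRIME: the Θ-box of EVERY summand is a polydisc in field-factor coordinates,
# so a pure tensor enters it on the PRODUCT of its slot norms; hence «level weights ⟹ qRegion ⊆ ⁿ˒°𝒰» with no unique-place hypothesis

PROOF-ONLY file (D-0012: 0 definitions, 0 `Prop` facts; abc-iut cell, rung LADDER-ABC:A2.RP → A2.RESCUE-H; seat abc-iut-rp-d3 gen 5, R-H k2 desk /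
prover hand; ROUND-2 input for the hull-reach family Q2: rows 8/15/16/18/20/27). TAKES NO SIDE on [IUTchIII] Cor. 3.12 or on any author; OUR
typed objects (Dupuy–Hilado's (Ind2) = ALL `ℤ_p`-lattice automorphisms of the log-shell, STRONGER-THAN-PRINT; abc-iut-c312-7's SHARP boxes;
hull-level Step (xi-f)); typed ≠ proved; instantiated ≠ endorsed. Inputs BY NAME: abc-iut-w5-d107's packet assembly
`Thm311.Real.exists_ind2Family_allSlots` and the frame bookkeeping of `qRegion_subset_thetaHull_settingDHVolSharp_of_multiReach`
(`Cor312LicenceOfMultiReach`, whose proof is followed line by line), abc-iut-w4-d087's `LicenceMover.purePacket_mem_iota_smul_normalizedPacket`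
(«`⊗_a w_a ∈ ι(c)·(R_I)^∼ ⟸ Π_a ‖w_a‖ ≤ ‖c‖`», `Cor312LicenceRealSharpMovers` §0 — there used under `huniq`; here at EVERY summand), this seat's
level mover `RHLevelMover.exists_mover_of_not_mem_logUnits_fibre` (p461981).

WHY. w5-d107's MULTI-REACH asks each slot's weight to be an INTEGER (`‖y_a‖ ≤ 1`, the last slot `t_Θ·y`): the witness of box membership is
`⊗_a y_a ∈ integerPacket ⊆ (R_I)^∼`. But `(R_{v⃗})^∼` IS the unit polydisc in the field-factor coordinates of `X_{v⃗} = ⊗_a K_{v_a}`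
(`IsmDHMover.mem_normalizedPacket_iff_norm_dEquiv_le`) and a pure tensor's coordinates have norm `Π_a ‖w_a‖` (`norm_dEquiv_purePacket`), so
`⊗_a w_a` lies in the sharp Θ-box `ι(t_{Θ,j,v_last})·(R_{v⃗})^∼` as soon as `Π_a ‖w_a‖ ≤ ‖t_{Θ,j,v_last}‖` — slot norms `> 1` allowed.
abc-iut-w4-d087 recorded this at primes with ONE place (`huniq`); nothing in it depends on `huniq` except the reduction to one summand,
which w5-d107's per-summand families make unnecessary.

* §1 **`qRegion_subset_thetaHull_settingDHVolSharp_of_multiReachFree`** / `…settingPrVolSharp…` — at the packet `(i+1, p)`, ANY fibre over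
  `p`: if for every summand `v⃗` there are movers `g_a ∈ Ism_{v_a}` and weights `w_a ∈ K_{v_a}` with `Π_a ‖w_a‖ ≤ ‖t_{Θ,i+1,v_last}‖` and
  `‖t_{q,v_last}‖ ≤ Π_a ‖g_a(w_a)‖`, then `qRegion (i+1) p ⊆ thetaHull (i+1) p`. `multiReachFree_of_multiReach`: w5-d107's boxed hypothesis
  is the special case `w_a = c_a·y_a`.
* §2 **`qRegion_subset_thetaHull_settingPrVolSharp_of_levelWeightsAt`** — the LEVEL-WEIGHTS door at ANY prime: per summand `v⃗`,
  non-log-units `y_a ∉ Λ_{v_a}`, log-units `z_a ∈ Λ_{v_a}` and integers `k_a` with `Π_a p^{−(k_a+1)}·‖y_a‖ ≤ ‖t_{Θ,i+1,v_last}‖` and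
  `‖t_{q,v_last}‖ ≤ Π_a p^{−k_a}·‖z_a‖` ⟹ the inclusion (weights `p^{k_a+1}·y_a`, moved by the level mover to norm `≥ p^{−k_a}·‖z_a‖`).
  This frees this seat's `RHLevelMoverBoxFree` (p465556) and row 20's `ReachCell` door from `huniq`, and gives rows 15/8/16 the
  inner-conductor credit (donor weights of norm `> 1` at deep places).
HONEST SCOPE: «the inclusion follows from the weights AS TYPED», nothing more; no cell of any table is decided here.
[cite: DupuyHilado2025, §3.7, §3.9, §4.9] [cite: WeilBNT1967, Ch. II §2, Th. 1] [cite: Mochizuki2012, IUTchIV Prop. 1.4 (i) p. 13; IUTchIII Cor. 3.12 Step (xi-f) p. 184]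
[claim: Mochizuki2012, status: disputed]
-/

noncomputable section

open Set Function
open scoped Pointwise

namespace Summit.ABC.IUTFork.Repair.RHLevelMover

open Thm311 Thm311.Real Cor312 Cor312.Setting Cor312Vol Literature.IUT.LogThetaLattice Literature.IUT.LogVolume
open Literature.NumberTheory.NumberFields NumberField IsDedekindDomain Metric

section Setting

variable {F : Type} [Field F] [NumberField F] (X : PilotData F) {logv : PadicLogs F} (hlog : LogvAnalytic logv)
  (M : Type) [Field M] [NumberField M]
  (archPk : ∀ (j : (thetaIndex X).Label) (vQ : (thetaIndex X).VQ), Set ((logShellsDH X logv).Packet j vQ))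
  (archSub : ∀ (j : (thetaIndex X).Label) (v : (thetaIndex X).V),
    Set ((logShellsDH X logv).Packet j ((thetaIndex X).over v)))
  (Ψ : ℤ → ∀ v : (thetaIndex X).V, v ∈ (thetaIndex X).Vbad → Set ((logShellsDH X logv).StarPacket v))
  (act : ℤ → ∀ v : (thetaIndex X).V, v ∈ (thetaIndex X).Vbad →
    (logShellsDH X logv).StarPacket v → Module.End ℚ ((logShellsDH X logv).StarPacket v))
  (Mmod : ℤ → ∀ j : (thetaIndex X).LabelStar, Set ((logShellsDH X logv).GlobalPacket j.1))
  (region : ℤ → ∀ j : (thetaIndex X).LabelStar, FinDivisor M → ∀ vQ : (thetaIndex X).VQ,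
    Set ((logShellsDH X logv).Packet j.1 vQ))
  (n : ℤ) {HT : Type} {LogLink : HT → HT → Type} {IsFull : ∀ {s t : HT}, LogLink s t → Prop}
  (lat : LGPGaussianLogThetaLattice LogLink IsFull)
  {Frd : Type} {IsoF : Frd → Frd → Type} {Ob : Frd → Type} {realify : Frd → Frd} {Strip : Type}
  {IsoS : Strip → Strip → Type} {Mv : ∀ v : (thetaIndex X).V, v ∈ (thetaIndex X).Vbad → Type}
  [∀ v h, Monoid (Mv v h)]
  (sig : GlobalLGPFrobenioidSignature (thetaIndex X).lstar (thetaIndex X).V (· ∈ (thetaIndex X).Vbad)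
    Frd IsoF Ob realify Strip IsoS Mv)
  (split : SplittingMonoids Mv) {ObΔ : Type} {N : ∀ v : (thetaIndex X).V, v ∈ (thetaIndex X).Vbad → Type}
  [∀ v h, Monoid (N v h)] (qData : QPilotData ObΔ N)
  (tq : ∀ (pp : Nat.Primes) (x : (thetaIndex X).Fibre (.inr pp)), haveI : Fact (pp : ℕ).Prime := ⟨pp.2⟩; kOf X pp.1 x)
  (t : ∀ (pp : Nat.Primes) (_ : Fin X.lstar) (x : (thetaIndex X).Fibre (.inr pp)),
    haveI : Fact (pp : ℕ).Prime := ⟨pp.2⟩; kOf X pp.1 x)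
  (htq0 : ∀ pp x, tq pp x ≠ 0)
  (htq1 : ∀ (pp : Nat.Primes) (x : (thetaIndex X).Fibre (.inr pp)),
    haveI : Fact (pp : ℕ).Prime := ⟨pp.2⟩; placeOf X pp.1 x ∉ X.S → ‖tq pp x‖ = 1)

/-! ## §1. Box-free multi-reach at any prime -/

/-- **BOX-FREE MULTI-REACH ⟹ `qRegion (i+1) p ⊆ thetaHull (i+1) p` at the sharp DH setting, ANY fibre over `p`.** For every summand `v⃗`
of the packet: movers `g_a ∈ Ism_{v_a}` (one per slot) and weights `w_a ∈ K_{v_a}` with `Π_a ‖w_a‖ ≤ ‖t_{Θ,i+1,v_last}‖` (so `⊗_a w_a` lies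
in the sharp Θ-box of that summand — a polydisc in field-factor coordinates) and `‖t_{q,v_last}‖ ≤ Π_a ‖g_a(w_a)‖`. abc-iut-w5-d107's proof
verbatim with the box witness replaced by abc-iut-w4-d087's `purePacket_mem_iota_smul_normalizedPacket`. Nonzero Θ-ideles.
[cite: DupuyHilado2025, §3.9, §4.9] [cite: Mochizuki2012, IUTchIV Prop. 1.4 (i) p. 13] [claim: Mochizuki2012, status: disputed] -/
theorem qRegion_subset_thetaHull_settingDHVolSharp_of_multiReachFree (ht0 : ∀ pp i x, t pp i x ≠ 0)
    (pp : Nat.Primes) (i : Fin (thetaIndex X).lstar)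
    (hreach : haveI : Fact (pp : ℕ).Prime := ⟨pp.2⟩
      ∀ e : (thetaIndex X).Caps (Setting.labelSucc i) → (thetaIndex X).Fibre (.inr pp),
        ∃ g : (thetaIndex X).Caps (Setting.labelSucc i) → ∀ x : (thetaIndex X).Fibre (.inr pp),
            (logShellsDH X logv).carrier x.1 ≃ₗ[ℚ] (logShellsDH X logv).carrier x.1,
          (∀ a x, g a x ∈ (logShellsDH X logv).ism x.1) ∧
          ∃ w : ∀ a, kOf X pp.1 (e a), (∏ a, ‖w a‖ ≤ ‖t pp i (e (Fin.last _))‖) ∧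
            ‖tq pp (e (Fin.last _))‖ ≤
              ∏ a, ‖(presAt X hlog pp).φ (e a) (g a (e a) (((presAt X hlog pp).φ (e a)).symm (w a)))‖) :
    (settingDHVolSharp X hlog M archPk archSub Ψ act Mmod region n lat sig split qData tq t htq0 htq1).qRegion
        (Setting.labelSucc i) (.inr pp) ⊆
      (settingDHVolSharp X hlog M archPk archSub Ψ act Mmod region n lat sig split qData tq t htq0 htq1).thetaHull
        (Setting.labelSucc i) (.inr pp) := by
  haveI : Fact (pp : ℕ).Prime := ⟨pp.2⟩
  haveI : Nonempty ((thetaIndex X).Caps (Setting.labelSucc i)) := ⟨0⟩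
  classical
  -- choose, for every summand, the movers, their `ℚ_p`-linear forms and the weights
  choose g hg w hw hreach using hreach
  choose g' hg' using fun e a x => (presAt X hlog pp).ism_linear x (g e a x) (hg e a x)
  -- the box point `z₀` over the pure tensors `⊗_a w_{v⃗,a}`
  obtain ⟨z₀, hz₀⟩ := (presAt X hlog pp).comparison_surjective (Setting.labelSucc i)
    (fun e => purePacket (pp : ℕ) ((presAt X hlog pp).kk e) (w e))
  have hz₀mem : z₀ ∈ (settingDHVolSharp X hlog M archPk archSub Ψ act Mmod region n lat sig split qData tq t htq0
      htq1).thetaRegion3 (Setting.labelSucc i) (.inr pp) := by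
    unfold settingDHVolSharp
    rw [thetaRegion3_thetaBoxDH]
    change z₀ ∈ (fun x => (presAt X hlog pp).factorMap (Setting.labelSucc i) x) ⁻¹'
      (presAt X hlog pp).boxOf (sharpBoxDH X hlog t pp (Setting.labelSucc i))
    rw [(presAt X hlog pp).factorMap_preimage_boxOf, Set.mem_preimage, hz₀]
    intro e _
    unfold sharpBoxDH
    rw [labelIdele_labelSucc]
    exact LicenceMover.purePacket_mem_iota_smul_normalizedPacket (pp : ℕ) ((presAt X hlog pp).kk e) (Fin.last _)
      (ht0 pp i (e (Fin.last _))) (w e) (hw e)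
  -- the hull: either everything, or the intersection of the hull-sets containing the possible images
  intro x hx
  have hnorm_q : ∀ (e : (thetaIndex X).Caps (Setting.labelSucc i) → (thetaIndex X).Fibre (.inr pp))
      (k : DIdx (pp : ℕ) ((presAt X hlog pp).kk e)),
      ‖(presAt X hlog pp).factorMap (Setting.labelSucc i) x ⟨e, k⟩‖ ≤ ‖tq pp (e (Fin.last _))‖ := by
    intro e k
    have hx' : (presAt X hlog pp).factorMap (Setting.labelSucc i) x ∈
        hullSet ((presAt X hlog pp).factorField (Setting.labelSucc i))
          ((presAt X hlog pp).centreOf fun e =>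
            iota (pp : ℕ) ((presAt X hlog pp).kk e) (Fin.last _) (tq pp (e (Fin.last _)))) := hx
    rw [hullSet, mem_polydisc] at hx'
    refine (hx' ⟨e, k⟩).trans_eq ?_
    show ‖dEquiv (pp : ℕ) ((presAt X hlog pp).kk e) (iota (pp : ℕ) ((presAt X hlog pp).kk e) (Fin.last _)
      (tq pp (e (Fin.last _)))) k‖ = _
    rw [norm_dEquiv_iota]
    rfl
  show x ∈ ((HullFrame.ofLocalFields (factorFieldDH X hlog (Setting.labelSucc i) (.inr pp))).comap
    (factorMapDH X hlog (Setting.labelSucc i) (.inr pp))).hull _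
  unfold HullFrame.hull
  split_ifs with hb
  · rintro H ⟨⟨H', hH', rfl⟩, hUH⟩
    obtain ⟨lam, hlam0, rfl⟩ := (HullFrame.mem_ofLocalFields_hul _).1 hH'
    change (presAt X hlog pp).factorMap (Setting.labelSucc i) x ∈
      hullSet ((presAt X hlog pp).factorField (Setting.labelSucc i)) lam
    rw [hullSet, mem_polydisc]
    rintro ⟨e, k⟩
    -- the (Ind2)-family of THIS summand's movers and the image of `z₀`
    obtain ⟨Φ, hΦ, hΦz⟩ := exists_ind2Family_allSlots X hlog pp i (g e) (hg e) (g' e) (hg' e)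
    have hΦz₀ := hΦz z₀ (fun e' a => w e' a) hz₀
    have himage : Φ (Setting.labelSucc i) (.inr pp) z₀ ∈
        ⋃₀ (settingDHVolSharp X hlog M archPk archSub Ψ act Mmod region n lat sig split qData tq t htq0 htq1).possibleImages
          (Setting.labelSucc i) (.inr pp) :=
      Set.mem_sUnion.2 ⟨_, ⟨Φ, Subgroup.subset_closure (Set.mem_union_right _ hΦ), rfl⟩, Set.mem_image_of_mem _ hz₀mem⟩
    have hnorm_image : ‖tq pp (e (Fin.last _))‖ ≤
        ‖(presAt X hlog pp).factorMap (Setting.labelSucc i) (Φ (Setting.labelSucc i) (.inr pp) z₀) ⟨e, k⟩‖ := by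
      rw [(presAt X hlog pp).factorMap_mk, hΦz₀]
      dsimp only
      rw [psi_purePacket_apply, norm_prod]
      refine (hreach e).trans_eq (Finset.prod_congr rfl fun a _ => ?_)
      rw [norm_factorEmb, hg', LinearEquiv.apply_symm_apply]
    have hmem : (presAt X hlog pp).factorMap (Setting.labelSucc i) (Φ (Setting.labelSucc i) (.inr pp) z₀) ∈
        hullSet ((presAt X hlog pp).factorField (Setting.labelSucc i)) lam := hUH himage
    rw [hullSet, mem_polydisc] at hmem
    exact ((hnorm_q e k).trans hnorm_image).trans (hmem ⟨e, k⟩)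
  · exact Set.mem_univ x

/-- **… and at the PRINT-NORMALISED sharp setting `settingPrVolSharp`** (same regions and frames). [claim: Mochizuki2012, status: disputed] -/
theorem qRegion_subset_thetaHull_settingPrVolSharp_of_multiReachFree (ht0 : ∀ pp i x, t pp i x ≠ 0)
    (pp : Nat.Primes) (i : Fin (thetaIndex X).lstar)
    (hreach : haveI : Fact (pp : ℕ).Prime := ⟨pp.2⟩
      ∀ e : (thetaIndex X).Caps (Setting.labelSucc i) → (thetaIndex X).Fibre (.inr pp),
        ∃ g : (thetaIndex X).Caps (Setting.labelSucc i) → ∀ x : (thetaIndex X).Fibre (.inr pp),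
            (logShellsDH X logv).carrier x.1 ≃ₗ[ℚ] (logShellsDH X logv).carrier x.1,
          (∀ a x, g a x ∈ (logShellsDH X logv).ism x.1) ∧
          ∃ w : ∀ a, kOf X pp.1 (e a), (∏ a, ‖w a‖ ≤ ‖t pp i (e (Fin.last _))‖) ∧
            ‖tq pp (e (Fin.last _))‖ ≤
              ∏ a, ‖(presAt X hlog pp).φ (e a) (g a (e a) (((presAt X hlog pp).φ (e a)).symm (w a)))‖) :
    (settingPrVolSharp X hlog M archPk archSub Ψ act Mmod region n lat sig split qData tq t htq0 htq1).qRegion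
        (Setting.labelSucc i) (.inr pp) ⊆
      (settingPrVolSharp X hlog M archPk archSub Ψ act Mmod region n lat sig split qData tq t htq0 htq1).thetaHull
        (Setting.labelSucc i) (.inr pp) :=
  qRegion_subset_thetaHull_settingDHVolSharp_of_multiReachFree X hlog M archPk archSub Ψ act Mmod region n lat sig split qData tq t htq0
    htq1 ht0 pp i hreach

/-- **w5-d107's BOXED multi-reach is the special case `w_a = c_a·y_a`** (`c_last = t_Θ`, `c_a = 1` otherwise, `‖y_a‖ ≤ 1`):
`Π_a ‖c_a y_a‖ = ‖t_Θ‖·Π_a ‖y_a‖ ≤ ‖t_Θ‖`. [folklore] -/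
theorem multiReachFree_of_multiReach (pp : Nat.Primes) (i : Fin (thetaIndex X).lstar)
    (e : (thetaIndex X).Caps (Setting.labelSucc i) → (thetaIndex X).Fibre (.inr pp))
    (h : haveI : Fact (pp : ℕ).Prime := ⟨pp.2⟩
      ∃ g : (thetaIndex X).Caps (Setting.labelSucc i) → ∀ x : (thetaIndex X).Fibre (.inr pp),
          (logShellsDH X logv).carrier x.1 ≃ₗ[ℚ] (logShellsDH X logv).carrier x.1,
        (∀ a x, g a x ∈ (logShellsDH X logv).ism x.1) ∧
        ∃ y : ∀ a, kOf X pp.1 (e a), (∀ a, ‖y a‖ ≤ 1) ∧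
          ‖tq pp (e (Fin.last _))‖ ≤ ∏ a, ‖(presAt X hlog pp).φ (e a) (g a (e a) (((presAt X hlog pp).φ (e a)).symm
            ((if a = Fin.last _ then t pp i (e a) else 1) * y a)))‖) :
    haveI : Fact (pp : ℕ).Prime := ⟨pp.2⟩
    ∃ g : (thetaIndex X).Caps (Setting.labelSucc i) → ∀ x : (thetaIndex X).Fibre (.inr pp),
        (logShellsDH X logv).carrier x.1 ≃ₗ[ℚ] (logShellsDH X logv).carrier x.1,
      (∀ a x, g a x ∈ (logShellsDH X logv).ism x.1) ∧
      ∃ w : ∀ a, kOf X pp.1 (e a), (∏ a, ‖w a‖ ≤ ‖t pp i (e (Fin.last _))‖) ∧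
        ‖tq pp (e (Fin.last _))‖ ≤
          ∏ a, ‖(presAt X hlog pp).φ (e a) (g a (e a) (((presAt X hlog pp).φ (e a)).symm (w a)))‖ := by
  haveI : Fact (pp : ℕ).Prime := ⟨pp.2⟩
  classical
  obtain ⟨g, hg, y, hy, hr⟩ := h
  refine ⟨g, hg, fun a => (if a = Fin.last _ then t pp i (e a) else 1) * y a, ?_, hr⟩
  -- `Π_a ‖c_a y_a‖ ≤ Π_a ‖c_a‖ = ‖t_Θ‖`
  calc ∏ a, ‖(if a = Fin.last _ then t pp i (e a) else 1) * y a‖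
      ≤ ∏ a, ‖(if a = Fin.last _ then t pp i (e a) else (1 : kOf X pp.1 (e a)))‖ := by
        refine Finset.prod_le_prod (fun a _ => norm_nonneg _) fun a _ => ?_
        rw [norm_mul]
        exact mul_le_of_le_one_right (norm_nonneg _) (hy a)
    _ = ‖t pp i (e (Fin.last _))‖ := by
        rw [← Finset.mul_prod_erase Finset.univ _ (Finset.mem_univ (Fin.last _)), if_pos rfl,
          Finset.prod_eq_one fun a ha => by rw [if_neg (Finset.ne_of_mem_erase ha)]; exact norm_one, mul_one]

/-! ## §2. Level weights at ANY prime -/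

/-- **LEVEL WEIGHTS ⟹ `qRegion (i+1) p ⊆ thetaHull (i+1) p`, ANY fibre over `p`** (frees `RHLevelMoverBoxFree`'s door from `huniq`).
Per summand `v⃗`: non-log-units `y_a ∉ Λ_{v_a}`, log-units `z_a ∈ Λ_{v_a}`, integers `k_a` with `Π_a p^{−(k_a+1)}·‖y_a‖ ≤ ‖t_{Θ,i+1,v_last}‖`
and `‖t_{q,v_last}‖ ≤ Π_a p^{−k_a}·‖z_a‖`. The weight `p^{k_a+1}·y_a` is carried by the level mover (p461981) to norm `≥ p^{−k_a}·‖z_a‖`.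
[cite: DupuyHilado2025, §3.9, §4.9] [cite: WeilBNT1967, Ch. II §2, Th. 1] [claim: Mochizuki2012, status: disputed] -/
theorem qRegion_subset_thetaHull_settingPrVolSharp_of_levelWeightsAt (ht0 : ∀ pp i x, t pp i x ≠ 0)
    (pp : Nat.Primes) (i : Fin (thetaIndex X).lstar)
    (hlev : haveI : Fact (pp : ℕ).Prime := ⟨pp.2⟩
      ∀ e : (thetaIndex X).Caps (Setting.labelSucc i) → (thetaIndex X).Fibre (.inr pp),
        ∃ (y z : ∀ a, kOf X pp.1 (e a)) (k : (thetaIndex X).Caps (Setting.labelSucc i) → ℤ),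
          (∀ a, y a ∉ (logUnits (kOf X pp.1 (e a)) : Set (kOf X pp.1 (e a)))) ∧
          (∀ a, z a ∈ (logUnits (kOf X pp.1 (e a)) : Set (kOf X pp.1 (e a)))) ∧
          (∏ a, ((pp : ℕ) : ℝ) ^ (-(k a + 1)) * ‖y a‖ ≤ ‖t pp i (e (Fin.last _))‖) ∧
          ‖tq pp (e (Fin.last _))‖ ≤ ∏ a, ((pp : ℕ) : ℝ) ^ (-(k a)) * ‖z a‖) :
    (settingPrVolSharp X hlog M archPk archSub Ψ act Mmod region n lat sig split qData tq t htq0 htq1).qRegion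
        (Setting.labelSucc i) (.inr pp) ⊆
      (settingPrVolSharp X hlog M archPk archSub Ψ act Mmod region n lat sig split qData tq t htq0 htq1).thetaHull
        (Setting.labelSucc i) (.inr pp) := by
  haveI hpF : Fact (pp : ℕ).Prime := ⟨pp.2⟩
  classical
  refine qRegion_subset_thetaHull_settingPrVolSharp_of_multiReachFree X hlog M archPk archSub Ψ act Mmod region n lat sig split qData tq
    t htq0 htq1 ht0 pp i fun e => ?_
  obtain ⟨y, z, k, hy, hz, hw, hbig⟩ := hlev e
  -- the weights `p^(k_a+1) • y_a` and their movers
  have hsu : ∀ a : (thetaIndex X).Caps (Setting.labelSucc i),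
      (((pp : ℕ) : ℚ_[pp]) ^ (-(k a) - 1)) • ((((pp : ℕ) : ℚ_[pp]) ^ (k a + 1)) • y a) = y a := by
    intro a
    rw [smul_smul, ← zpow_add₀ (Nat.cast_ne_zero.2 pp.2.ne_zero), show -(k a) - 1 + (k a + 1) = 0 by ring, zpow_zero,
      one_smul]
  have hmov : ∀ a : (thetaIndex X).Caps (Setting.labelSucc i), ∃ g ∈ (logShellsDH X logv).ism (e a).1,
      ((pp : ℕ) : ℝ) ^ (-(k a)) * ‖z a‖ ≤
        ‖(presAt X hlog pp).φ (e a) (g (((presAt X hlog pp).φ (e a)).symm ((((pp : ℕ) : ℚ_[pp]) ^ (k a + 1)) • y a)))‖ :=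
    fun a => exists_mover_of_not_mem_logUnits_fibre X hlog pp (e a) (hsu a) (hy a) (hz a)
  choose g hg hreach using hmov
  refine ⟨fun a x => if h : x = e a then h ▸ g a else LinearEquiv.refl ℚ _, fun a x => ?_,
    fun a => (((pp : ℕ) : ℚ_[pp]) ^ (k a + 1)) • y a, ?_, ?_⟩
  · -- movers in `Ism`
    dsimp only
    split_ifs with h
    · subst h; exact hg a
    · exact (logShellsDH X logv).one_mem_ism x.1
  · -- the product of the weights fits the Θ-box
    refine le_trans (le_of_eq (Finset.prod_congr rfl fun a _ => ?_)) hw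
    show ‖(((pp : ℕ) : ℚ_[pp]) ^ (k a + 1)) • y a‖ = _
    rw [norm_zpow_prime_smul]
  · -- the reached product dominates `t_q`
    refine hbig.trans (Finset.prod_le_prod (fun a _ => by positivity) fun a _ => ?_)
    have hga : (if h : e a = e a then h ▸ g a else LinearEquiv.refl ℚ _) = g a := by rw [dif_pos rfl]
    show ((pp : ℕ) : ℝ) ^ (-(k a)) * ‖z a‖ ≤
      ‖(presAt X hlog pp).φ (e a) ((if h : e a = e a then h ▸ g a else LinearEquiv.refl ℚ _)
        (((presAt X hlog pp).φ (e a)).symm ((((pp : ℕ) : ℚ_[pp]) ^ (k a + 1)) • y a)))‖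
    rw [hga]
    exact hreach a

end Setting

end Summit.ABC.IUTFork.Repair.RHLevelMover

end
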